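import Literature.Algebra.Lie.LefschetzInvariantFormIsotypicOrthogonal
import Literature.Algebra.Lie.LefschetzModuleSelfAdjoint
import HarnessLib

/-!
# Poincaré-type pairings (`h` skew, `e = L` SELF-adjoint) versus invariant forms (`h`, `e` skew): Looijenga–Lunts' sign twist
# `φ = ψ(·, J·)` by the string-sign operator `J(eⁱp) = (−1)ⁱeⁱp`; consequences for a Poincaré-type `ψ` — the primary decomposition is
# `ψ`-orthogonal, `ψ` is non-degenerate iff all `ψ(p, eᵏq)|_{P_{−k}}` are, `(⊕_{k∈S} M[k])^⊥ = ⊕_{k∉S} M[k]`, `ψ|_{M[k]}` is non-degenerate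

[topic Algebra/Lie]

Topic `Literature/Algebra/Lie` (namespace `Literature.Algebra.Lie`, `….HasLefschetzProperty`).  Lane `lit-hodgefound` (Track 2 foundations library), prover
seat `lit-hodgefound-p09` (generation 59, row g59-#12); sequel of rows g59-#8 `LefschetzInvariantFormIsotypicOrthogonal` (for INVARIANT forms: blocks orthogonal,
non-degenerate iff all `β_k` are, `(⊕_{k∈S} M[k])^⊥ = ⊕_{k∉S} M[k]`), g59-#6 (`semiconj_adjoint_of_isAdjointPair`), g30-#3 `LefschetzModuleSelfAdjoint` (POINCARÉ-TYPE
pairings: `apply_pow_primitive_pow_primitive_eq_zero`), A1-126 `LefschetzInvariantFormExistence` (`stringCoord`, `stringForm`, `exists_bilinForm_symm_separatingLeft`)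
and `LefschetzModuleStringReversal` (`linearMap_ext_of_strings`).  THEOREMS ONLY (no `def`, no named fact, no instance, no notation; D-0026 net debt `0`).

THE POINT.  Two conventions for "compatible bilinear form on a Lefschetz module" live in the tree: the INVARIANT forms of Looijenga–Lunts (1.3) (`h` AND
`e` skew: "`φ(e_a m, m′) + φ(m, e_a m′) = 0`") and the POINCARÉ-TYPE pairings of André §1.1 / geometry (`h` skew — complementary degrees pair — but
`e = L` SELF-adjoint: "`L`, `*_L`, `*_H` et `ᶜΛ` sont auto-adjoints relativement à l'accouplement de dualité de Poincaré").  Looijenga–Lunts pass from the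
second to the first by a SIGN TWIST: "define `φ(a, b) := (−1)^q ∫(ab)` if `a` is homogeneous of degree `n + 2q` or `n + 2q + 1`. If this form is nondegenerate
… then the form `(a, b) ↦ ∫(ab)` is also nondegenerate".  This file proves the twist abstractly and uses it to transfer row g59-#8 to Poincaré-type pairings:
* §0 (tools, form-free) ★ **every Lefschetz module carries a non-degenerate invariant form** (`φ_β` for non-degenerate `β_k`), hence ★★ **`⊕_{k ∈ S} M[k]` and
  `⊕_{k ∉ S} M[k]` are complementary** for every `S ⊆ ℕ`;
* §1 (the twist, any operators) for `J` commuting with `h` and ANTIcommuting with `e`: `ψ(·, J·)` has `h` skew iff… — precisely: `u` skew for `ψ` and `Ju = uJ`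
  ⟹ `u` skew for `ψ(·, J·)`; `u` self-adjoint for `ψ` and `Ju = −uJ` ⟹ `u` skew for `ψ(·, J·)`; `u` skew and `Ju = −uJ` ⟹ `u` self-adjoint for `ψ(·, J·)`; so
  ★★ **`ψ` Poincaré-type ⟹ `ψ(·, J·) ∈ invariantForms h e`**; non-degeneracy is preserved for bijective `J`; `(ψ(·, J·))`-orthogonals are `J⁻¹` of
  `ψ`-orthogonals;
* §2 ★★ **THE STRING-SIGN OPERATOR EXISTS: `J(eⁱp) = (−1)ⁱ eⁱp`** (`p ∈ P_{−k}`, `i ≤ k`; built from the string coordinates `C_{k,i}`), and any such `J`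
  satisfies `J² = 1`, `Jh = hJ`, `Je = −eJ`, commutes with every intertwiner, preserves every `K[e, ᶜΛ]`-stable subspace, and twists the primitive forms by
  signs: `β_k(ψ(·, J·)) = (−1)ᵏ β_k(ψ)`;
* §3 (POINCARÉ-TYPE `ψ`: `h` skew, `e` self-adjoint) ★ the primary decomposition is `ψ`-orthogonal; ★★★ **`ψ` is non-degenerate iff every
  `γ_k(p, q) = ψ(p, eᵏq)` is non-degenerate on `P_{−k}`**; for `ψ` non-degenerate ★★ **`(⊕_{k∈S} M[k])^{⊥ψ} = ⊕_{k∉S} M[k]`**, `M = M_S ⊕ M_S^⊥`, ★★ **`ψ|_{M_S}` and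
  `ψ|_{M[k]}` are non-degenerate**; and ★ the `ψ`-adjoint of a morphism of Lefschetz modules (Poincaré-type on both sides) is a morphism of Lefschetz modules.

## Sources, VERBATIM

* E. Looijenga, V. A. Lunts [LooijengaLunts1997] (held `paper:arxiv-alg-geom_9604014`), p0005 L16–L30: "Many Lefschetz modules have the additional structure of
  an algebra. Let `A = ⊕_{i=0}^{2n} A_i` be a graded-commutative algebra with `A_0 = K`. We say that `A` is a Lefschetz algebra of depth `n` if `A[n]` is a
  Lefschetz module of depth `n` over `A_2`. Such a Lefschetz module can be endowed with an invariant `(−)ⁿ`-symmetric bilinear form: let `∫ : A → K` be a linear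
  form that is an isomorphism in degree `2n` and zero in all other degrees and define `φ(a, b) := (−1)^q ∫(ab)` if `a` is homogeneous of degree `n + 2q` or
  `n + 2q + 1`. If this form is nondegenerate (which is for instance the case when `A[n]` is irreducible as a Lefschetz module), then the form `(a, b) ↦ ∫(ab)` is
  also nondegenerate and so `A` becomes a Frobenius algebra (in the graded sense)."; p0005 L1–L6 (1.3) "`φ(e_a m, m′) + φ(m, e_a m′) = 0`"; p0006 L10–L14 (1.6,
  proof) "This decomposition is `φ`-perpendicular".
* Y. André, *Pour une théorie inconditionnelle des motifs*, Publ. Math. IHÉS 83 (1996) [Andre1996Motifs] (held `paper:doi-10-1007-bf02698643`), §1.1 (p. 11 =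
  p0008 L11–L14): "Remarquons aussi que `L`, `*_L`, `*_H` et `ᶜΛ` sont auto-adjoints relativement à l'accouplement de dualité de Poincaré `(x, y) ↦ ∫ x ∪ y`."
* R. Goodman, N. R. Wallach [GoodmanWallachGTM255] (held), p0253 L9–L16 (invariant forms ↔ `Hom_𝔤(V, V*)`; "The radical of `Ω` is a proper `𝔤`-invariant
  subspace"); §4.1.6 (4.6) (p0280) (`V = ⊕_λ V_(λ)`).

## What is proved (`M_S := ⨆ k ∈ S, ⨆ i, (primitiveSpace h e k).map (e ^ i)`; `hJ : ∀ k, ∀ p ∈ P_{−k}, ∀ i ≤ k, J (eⁱp) = (−1)ⁱ • eⁱp`)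

* §0 ★ **`HasLefschetzProperty.exists_nondegenerate_mem_invariantForms`**, ★★ **`….isCompl_biSup_biSup_compl`**, `….finrank_biSup_add_finrank_biSup_compl`.
* §1 `isSkewAdjoint_compl₂_of_isSkewAdjoint`, `isSkewAdjoint_compl₂_of_isSelfAdjoint`, `isSelfAdjoint_compl₂_of_isSkewAdjoint`,
  ★★ **`compl₂_mem_invariantForms_of_isSelfAdjoint`** (the twist of a Poincaré-type pairing is invariant), `nondegenerate_compl₂_iff`, `orthogonal_compl₂_eq_comap`.
* §2 ★★ **`HasLefschetzProperty.exists_stringSign`**, `….stringSign_mul_self`, `….stringSign_comm_h`, `….stringSign_anticomm_e`, ★ `….stringSign_comm_intertwiner`,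
  `….stringSign_apply_mem_of_stable`, ★ `primitiveForms_compl₂_of_stringSign` (`β_k(ψ(·, J·)) = (−1)ᵏ • β_k(ψ)`).
* §3 ★ **`HasLefschetzProperty.biSup_le_orthogonal_of_disjoint_of_isSelfAdjoint`**, ★★★ **`….nondegenerate_iff_forall_primitiveForms_of_isSelfAdjoint`**,
  ★★ **`….orthogonal_biSup_eq_of_isSelfAdjoint`**, **`….isCompl_biSup_orthogonal_of_isSelfAdjoint`**, ★★ **`….nondegenerate_restrict_biSup_of_isSelfAdjoint`**,
  **`….nondegenerate_restrict_iSup_map_pow_of_isSelfAdjoint`**, ★ `semiconj_adjoint_of_isSelfAdjoint_of_isSkewAdjoint` (Poincaré-type adjoints intertwine).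

## SCOPE

(a) Any field of characteristic `0`, finite-dimensional Lefschetz modules with ONE pair `(h, e)`.  (b) The `(−)ⁿ`-SYMMETRY clause of the twisted form (for a
graded-commutative algebra) is not formalised here (it needs the graded symmetry of `∫ ab`, a statement about Lefschetz ALGEBRAS); the string-sign operator
`J` used here is `(−1)ⁱ` on `eⁱP_{−k}`, which differs from Looijenga–Lunts' degree sign `(−1)^q` by a sign depending only on the string type `k` — both commute
with `h` and anticommute with `e`, which is all that is used.  (c) No complex tori; nothing about the Hodge conjecture.
-/

namespace Literature.Algebra.Lie

open Module Function Set
open LinearMap (BilinForm)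
open HasLefschetzProperty (primitiveSpace mem_primitiveSpace_iff)

variable {K : Type*} [Field K] {M : Type*} [AddCommGroup M] [Module K M] {ψ : BilinForm K M} {h e J : Module.End K M} {N : Submodule K M}

/-- `⊕_{k′ ∈ {k}} M[k′] = M[k]`. [folklore] -/
private theorem biSup_singleton₇₃ (k : ℕ) :
    ⨆ k' ∈ ({k} : Set ℕ), ⨆ i : ℕ, (primitiveSpace h e k').map (e ^ i) = ⨆ i : ℕ, (primitiveSpace h e k).map (e ^ i) := by
  simp only [Set.mem_singleton_iff, iSup_iSup_eq_left]

/-- `u` skew for `B` is skew for `Bᵀ`. [cite: LooijengaLunts1997, §1 (1.3) p0005 L4–L6] -/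
private theorem isSkewAdjoint_flip₇₃ {B : BilinForm K M} {u : Module.End K M} (hu : B.IsSkewAdjoint u) : (LinearMap.flip B).IsSkewAdjoint u := by
  intro x y
  rw [LinearMap.flip_apply, LinearMap.flip_apply, Pi.neg_apply, map_neg, LinearMap.neg_apply]
  have h1 := hu y x
  rw [Pi.neg_apply, map_neg] at h1
  rw [h1, neg_neg]

/-- `u` self-adjoint for `B` is self-adjoint for `Bᵀ`. [cite: Andre1996Motifs, §1.1 (p0008 L11–L14)] -/
private theorem isSelfAdjoint_flip₇₃ {B : BilinForm K M} {u : Module.End K M} (hu : B.IsSelfAdjoint u) : (LinearMap.flip B).IsSelfAdjoint u :=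
  fun x y ↦ by rw [LinearMap.flip_apply, LinearMap.flip_apply]; exact (hu y x).symm

/-- `(c • B)` is non-degenerate iff `B` is (`c ≠ 0`). [folklore] -/
private theorem nondegenerate_smul_iff₇₃ {V : Type*} [AddCommGroup V] [Module K V] {c : K} (hc : c ≠ 0) {B : BilinForm K V} :
    (c • B).Nondegenerate ↔ B.Nondegenerate := by
  constructor
  · rintro ⟨hl, hr⟩
    refine ⟨fun x hx ↦ hl x fun y ↦ ?_, fun y hy ↦ hr y fun x ↦ ?_⟩
    · rw [LinearMap.smul_apply, LinearMap.smul_apply, hx y, smul_zero]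
    · rw [LinearMap.smul_apply, LinearMap.smul_apply, hy x, smul_zero]
  · rintro ⟨hl, hr⟩
    refine ⟨fun x hx ↦ hl x fun y ↦ ?_, fun y hy ↦ hr y fun x ↦ ?_⟩
    · have h1 := hx y
      rw [LinearMap.smul_apply, LinearMap.smul_apply, smul_eq_mul] at h1
      exact (mul_eq_zero.1 h1).resolve_left hc
    · have h1 := hy x
      rw [LinearMap.smul_apply, LinearMap.smul_apply, smul_eq_mul] at h1
      exact (mul_eq_zero.1 h1).resolve_left hc

/-! ### §1 The sign twist `ψ ↦ ψ(·, J·)` -/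

section Twist

/-- `u` skew for `ψ` and `Ju = uJ` ⟹ `u` skew for `ψ(·, J·)`. [cite: LooijengaLunts1997, §1 p0005 L21–L26 (the twist `φ(a, b) = (−1)^q ∫(ab)`) and (1.3) L4–L6] -/
theorem isSkewAdjoint_compl₂_of_isSkewAdjoint {u : Module.End K M} (hu : ψ.IsSkewAdjoint u) (hJu : ∀ x, J (u x) = u (J x)) :
    (ψ.compl₂ J).IsSkewAdjoint u := by
  intro x y
  rw [LinearMap.compl₂_apply, LinearMap.compl₂_apply, hu x (J y), Pi.neg_apply, Pi.neg_apply, map_neg, map_neg, map_neg, hJu y]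

/-- **`u` SELF-adjoint for `ψ` and `Ju = −uJ` ⟹ `u` SKEW for `ψ(·, J·)`** (`ψ(ux, Jy) = ψ(x, uJy) = −ψ(x, J(uy))`): the twist turns André's self-adjoint `L` into
Looijenga–Lunts' skew `e`. [cite: LooijengaLunts1997, §1 p0005 L21–L26] [cite: Andre1996Motifs, §1.1 (p0008 L11–L14)] -/
theorem isSkewAdjoint_compl₂_of_isSelfAdjoint {u : Module.End K M} (hu : ψ.IsSelfAdjoint u) (hJu : ∀ x, J (u x) = -(u (J x))) :
    (ψ.compl₂ J).IsSkewAdjoint u := by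
  intro x y
  rw [LinearMap.compl₂_apply, LinearMap.compl₂_apply, hu x (J y), Pi.neg_apply, map_neg, hJu y, neg_neg]

/-- `u` skew for `ψ` and `Ju = −uJ` ⟹ `u` self-adjoint for `ψ(·, J·)` (the twist the other way). [cite: LooijengaLunts1997, §1 p0005 L21–L26]
[cite: Andre1996Motifs, §1.1 (p0008 L11–L14)] -/
theorem isSelfAdjoint_compl₂_of_isSkewAdjoint {u : Module.End K M} (hu : ψ.IsSkewAdjoint u) (hJu : ∀ x, J (u x) = -(u (J x))) :
    (ψ.compl₂ J).IsSelfAdjoint u := by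
  intro x y
  rw [LinearMap.compl₂_apply, LinearMap.compl₂_apply, hu x (J y), Pi.neg_apply, hJu y]

/-- ★★ **THE TWIST OF A POINCARÉ-TYPE PAIRING IS AN INVARIANT FORM**: `h` skew and `e` self-adjoint for `ψ`, `Jh = hJ`, `Je = −eJ` ⟹ `ψ(·, J·) ∈ invariantForms h e`.
[cite: LooijengaLunts1997, §1 p0005 L21–L26 ("Such a Lefschetz module can be endowed with an invariant (−)ⁿ-symmetric bilinear form …")] [cite: Andre1996Motifs, §1.1 (p0008 L11–L14)] -/
theorem compl₂_mem_invariantForms_of_isSelfAdjoint (hψh : ψ.IsSkewAdjoint h) (hψe : ψ.IsSelfAdjoint e) (hJh : ∀ x, J (h x) = h (J x))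
    (hJe : ∀ x, J (e x) = -(e (J x))) : ψ.compl₂ J ∈ invariantForms h e :=
  ⟨isSkewAdjoint_compl₂_of_isSkewAdjoint hψh hJh, isSkewAdjoint_compl₂_of_isSelfAdjoint hψe hJe⟩

/-- **The twist preserves non-degeneracy** (`J` bijective): "If this form is nondegenerate … then the form `(a, b) ↦ ∫(ab)` is also nondegenerate".
[cite: LooijengaLunts1997, §1 p0005 L26–L30] -/
theorem nondegenerate_compl₂_iff (hJ : Bijective J) : LinearMap.BilinForm.Nondegenerate (ψ.compl₂ J) ↔ ψ.Nondegenerate := by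
  constructor
  · rintro ⟨hl, hr⟩
    refine ⟨fun x hx ↦ hl x fun y ↦ by rw [LinearMap.compl₂_apply]; exact hx (J y), fun y hy ↦ ?_⟩
    obtain ⟨y', rfl⟩ := hJ.2 y
    have h1 : y' = 0 := hr y' fun x ↦ by rw [LinearMap.compl₂_apply]; exact hy x
    rw [h1, map_zero]
  · rintro ⟨hl, hr⟩
    refine ⟨fun x hx ↦ hl x fun y ↦ ?_, fun y hy ↦ hJ.1 ?_⟩
    · obtain ⟨y', rfl⟩ := hJ.2 y
      have h1 := hx y'
      rwa [LinearMap.compl₂_apply] at h1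
    · rw [map_zero]
      exact hr (J y) fun x ↦ by rw [← LinearMap.compl₂_apply]; exact hy x

/-- The orthogonal for the twisted form is `J⁻¹` of the orthogonal: `{y : ψ(N, Jy) = 0} = J⁻¹ N^{⊥ψ}`. [cite: LooijengaLunts1997, §1 (1.6) proof p0006 L9–L14] -/
theorem orthogonal_compl₂_eq_comap (N : Submodule K M) : LinearMap.BilinForm.orthogonal (ψ.compl₂ J) N = (ψ.orthogonal N).comap J := by
  ext y
  rw [LinearMap.BilinForm.mem_orthogonal_iff, Submodule.mem_comap, LinearMap.BilinForm.mem_orthogonal_iff]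
  simp only [LinearMap.compl₂_apply]

end Twist

/-! ### §0 Tools: a non-degenerate invariant form always exists; complementary block sums are complementary subspaces -/

namespace HasLefschetzProperty

variable [CharZero K] [FiniteDimensional K M]

/-- ★ **Every Lefschetz module carries a NON-DEGENERATE invariant form** (`φ_β` with every `β_k` non-degenerate symmetric, A1-126 `stringForm`; its
non-degeneracy from `separatingLeft_stringForm`). [cite: LooijengaLunts1997, §1 (1.16) p0008 L77–L83 ("always admits a nondegenerate invariant … form")] -/
theorem exists_nondegenerate_mem_invariantForms (L : HasLefschetzProperty h e) (hgr : IsZGrading h) :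
    ∃ φ : BilinForm K M, φ ∈ invariantForms h e ∧ φ.Nondegenerate := by
  have hs := L.isStringReversal_lefschetzInvolution hgr
  choose β _ hβ using fun k : ℕ ↦ exists_bilinForm_symm_separatingLeft K ↥(primitiveSpace h e k)
  exact ⟨L.stringForm hgr hs β (finrank K M), ⟨L.isSkewAdjoint_stringForm_h hgr hs, L.isSkewAdjoint_stringForm_e hgr hs⟩,
    LinearMap.BilinForm.Nondegenerate.ofSeparatingLeft (L.separatingLeft_stringForm hgr hs le_rfl fun k _ ↦ hβ k)⟩

/-- ★★ **`⊕_{k ∈ S} M[k]` AND `⊕_{k ∉ S} M[k]` ARE COMPLEMENTARY** for every `S ⊆ ℕ` (row g59-#8 for any non-degenerate invariant form: the second is the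
orthogonal of the first). [cite: GoodmanWallachGTM255, §4.1.6 Prop. 4.1.15 and (4.6) (p0280, "`V = ⊕_λ V_(λ)`")] [cite: LooijengaLunts1997, §1 (1.6) proof p0006 L10–L14] -/
theorem isCompl_biSup_biSup_compl (L : HasLefschetzProperty h e) (hgr : IsZGrading h) (S : Set ℕ) :
    IsCompl (⨆ k ∈ S, ⨆ i : ℕ, (primitiveSpace h e k).map (e ^ i)) (⨆ k ∈ Sᶜ, ⨆ i : ℕ, (primitiveSpace h e k).map (e ^ i)) := by
  obtain ⟨φ, hφ, hφn⟩ := L.exists_nondegenerate_mem_invariantForms hgr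
  have h1 := L.isCompl_biSup_orthogonal hgr hφ.1 hφ.2 hφn S
  rwa [L.orthogonal_biSup_eq hgr hφ.1 hφ.2 hφn S] at h1

/-- `dim ⊕_{k ∈ S} M[k] + dim ⊕_{k ∉ S} M[k] = dim M`. [cite: GoodmanWallachGTM255, §4.1.6 Prop. 4.1.15 and (4.6) (p0280)] -/
theorem finrank_biSup_add_finrank_biSup_compl (L : HasLefschetzProperty h e) (hgr : IsZGrading h) (S : Set ℕ) :
    finrank K ↥(⨆ k ∈ S, ⨆ i : ℕ, (primitiveSpace h e k).map (e ^ i)) + finrank K ↥(⨆ k ∈ Sᶜ, ⨆ i : ℕ, (primitiveSpace h e k).map (e ^ i)) =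
      finrank K M :=
  Submodule.finrank_add_eq_of_isCompl (L.isCompl_biSup_biSup_compl hgr S)

/-! ### §2 The string-sign operator `J(eⁱp) = (−1)ⁱ eⁱp` -/

/-- ★★ **THE STRING-SIGN OPERATOR EXISTS**: there is `J ∈ End(M)` with `J(eⁱp) = (−1)ⁱ eⁱp` for all `p ∈ P_{−k}`, `i ≤ k` (namely `Σ_{k<dim M} Σ_{i≤k} (−1)ⁱ eⁱC_{k,i}`
with the string coordinates `C_{k,i}` of A1-126). [cite: LooijengaLunts1997, §1 p0005 L21–L26 (the sign `(−1)^q` on `M_{n+2q} ⊕ M_{n+2q+1}`) and (1.6) proof p0006 L10–L12]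
[cite: Andre1996Motifs, §1.1 (Lefschetz decomposition, p0008)] -/
theorem exists_stringSign (L : HasLefschetzProperty h e) (hgr : IsZGrading h) :
    ∃ J : Module.End K M, ∀ k, ∀ p ∈ primitiveSpace h e k, ∀ i ≤ k, J ((e ^ i) p) = (-1 : K) ^ i • (e ^ i) p := by
  have hs := L.isStringReversal_lefschetzInvolution hgr
  refine ⟨∑ k ∈ Finset.range (finrank K M), ∑ i ∈ Finset.range (k + 1),
      ((-1 : K) ^ i) • (e ^ i * stringCoord e (L.lefschetzInvolution hgr) k i), fun k' p hp j hj ↦ ?_⟩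
  by_cases hk' : k' < finrank K M
  · rw [LinearMap.sum_apply, Finset.sum_eq_single_of_mem k' (Finset.mem_range.2 hk') fun k _ hk ↦ ?_, LinearMap.sum_apply,
      Finset.sum_eq_single_of_mem j (Finset.mem_range.2 (Nat.lt_succ_of_le hj)) fun i _ hi ↦ ?_, LinearMap.smul_apply,
      Module.End.mul_apply, hs.stringCoord_apply_pow_primitive hp hj, if_pos ⟨rfl, rfl⟩]
    · rw [LinearMap.smul_apply, Module.End.mul_apply, hs.stringCoord_apply_pow_primitive hp hj, if_neg (fun hc ↦ hi hc.1.symm), map_zero, smul_zero]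
    · rw [LinearMap.sum_apply]
      exact Finset.sum_eq_zero fun i _ ↦ by
        rw [LinearMap.smul_apply, Module.End.mul_apply, hs.stringCoord_apply_pow_primitive hp hj, if_neg (fun hc ↦ hk hc.2.symm), map_zero,
          smul_zero]
  · rw [L.primitive_eq_zero_of_finrank_le (not_lt.1 hk') hp, map_zero, map_zero, smul_zero]

/-- **`J² = 1`** for a string-sign operator. [cite: LooijengaLunts1997, §1 p0005 L21–L26] -/
theorem stringSign_mul_self (L : HasLefschetzProperty h e) (hgr : IsZGrading h)
    (hJ : ∀ k, ∀ p ∈ primitiveSpace h e k, ∀ i ≤ k, J ((e ^ i) p) = (-1 : K) ^ i • (e ^ i) p) : J * J = 1 :=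
  L.linearMap_ext_of_strings hgr fun k p hp j hj ↦ by
    rw [Module.End.mul_apply, Module.End.one_apply, hJ k p hp j hj, map_smul, hJ k p hp j hj, smul_smul, ← mul_pow, neg_one_mul, neg_neg,
      one_pow, one_smul]

/-- **`Jh = hJ`** (`J` is a scalar on each `eⁱP_{−k} ⊆ M_{2i−k}`). [cite: LooijengaLunts1997, §1 p0005 L21–L26] -/
theorem stringSign_comm_h (L : HasLefschetzProperty h e) (hgr : IsZGrading h)
    (hJ : ∀ k, ∀ p ∈ primitiveSpace h e k, ∀ i ≤ k, J ((e ^ i) p) = (-1 : K) ^ i • (e ^ i) p) : ∀ x, J (h x) = h (J x) := fun x ↦ by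
  suffices hc : J * h = h * J from LinearMap.congr_fun hc x
  refine L.linearMap_ext_of_strings hgr fun k p hp j hj ↦ ?_
  have hdeg : h ((e ^ j) p) = ((-(k : ℤ) + 2 * (j : ℕ) : ℤ) : K) • (e ^ j) p :=
    mem_degreeSpace_iff.1 (L.pow_apply_mem (mem_primitiveSpace_iff.1 hp).1 j)
  rw [Module.End.mul_apply, Module.End.mul_apply, hdeg, map_smul, hJ k p hp j hj, map_smul, hdeg, smul_comm]

/-- **`Je = −eJ`** (`J(e·eʲp) = (−1)^{j+1} e^{j+1}p = −e(J eʲp)`; at the top of a string both sides vanish). [cite: LooijengaLunts1997, §1 p0005 L21–L26]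
[cite: Andre1996Motifs, §1.1 (p0008 L11–L14)] -/
theorem stringSign_anticomm_e (L : HasLefschetzProperty h e) (hgr : IsZGrading h)
    (hJ : ∀ k, ∀ p ∈ primitiveSpace h e k, ∀ i ≤ k, J ((e ^ i) p) = (-1 : K) ^ i • (e ^ i) p) : ∀ x, J (e x) = -(e (J x)) := fun x ↦ by
  suffices hc : J * e = -(e * J) by
    have h1 := LinearMap.congr_fun hc x
    rwa [LinearMap.neg_apply] at h1
  refine L.linearMap_ext_of_strings hgr fun k p hp j hj ↦ ?_
  have h1 : e ((e ^ j) p) = (e ^ (j + 1)) p := by rw [pow_succ', Module.End.mul_apply]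
  rw [Module.End.mul_apply, LinearMap.neg_apply, Module.End.mul_apply, hJ k p hp j hj, map_smul, h1]
  by_cases hj' : j + 1 ≤ k
  · rw [hJ k p hp (j + 1) hj', pow_succ, mul_neg_one, neg_smul]
  · rw [pow_apply_primitive_of_lt hp (by omega), map_zero, smul_zero, neg_zero]

/-- ★ **A string-sign operator commutes with every intertwiner** (`T(eⁱp) = e′ⁱTp` with `Tp` primitive of the same type).
[cite: LooijengaLunts1997, §1 p0005 L21–L26 and (1.6) proof p0006 L10–L12] -/
theorem stringSign_comm_intertwiner (L : HasLefschetzProperty h e) (hgr : IsZGrading h)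
    (hJ : ∀ k, ∀ p ∈ primitiveSpace h e k, ∀ i ≤ k, J ((e ^ i) p) = (-1 : K) ^ i • (e ^ i) p)
    {M' : Type*} [AddCommGroup M'] [Module K M'] {h' e' J' : Module.End K M'}
    (hJ' : ∀ k, ∀ p ∈ primitiveSpace h' e' k, ∀ i ≤ k, J' ((e' ^ i) p) = (-1 : K) ^ i • (e' ^ i) p) {T : M →ₗ[K] M'}
    (hh : ∀ x, T (h x) = h' (T x)) (he : ∀ x, T (e x) = e' (T x)) : ∀ x, T (J x) = J' (T x) := fun x ↦ by
  suffices hc : T ∘ₗ J = J' ∘ₗ T from LinearMap.congr_fun hc x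
  refine L.linearMap_ext_of_strings hgr fun k p hp j hj ↦ ?_
  rw [LinearMap.comp_apply, LinearMap.comp_apply, hJ k p hp j hj, map_smul, apply_pow_of_semiconj he,
    hJ' k (T p) (apply_mem_primitiveSpace_of_semiconj hh he hp) j hj]

/-- **A string-sign operator preserves every `K[e, ᶜΛ]`-stable subspace** (`N = ⊕_k ⊕_i eⁱ(N ∩ P_{−k})`). [cite: LooijengaLunts1997, §1 (1.6) proof p0006 L10–L12] -/
theorem stringSign_apply_mem_of_stable (L : HasLefschetzProperty h e) (hgr : IsZGrading h)
    (hJ : ∀ k, ∀ p ∈ primitiveSpace h e k, ∀ i ≤ k, J ((e ^ i) p) = (-1 : K) ^ i • (e ^ i) p)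
    (heN : ∀ x ∈ N, e x ∈ N) (hfN : ∀ x ∈ N, L.dual hgr x ∈ N) : ∀ x ∈ N, J x ∈ N := by
  intro x hx
  rw [L.eq_iSup_map_pow_inf_primitiveSpace_of_stable hgr heN hfN] at hx
  have hle : (⨆ k : ℕ, ⨆ i : ℕ, (N ⊓ primitiveSpace h e k).map (e ^ i)) ≤ N.comap J :=
    iSup_le fun k ↦ iSup_le fun i ↦ Submodule.map_le_iff_le_comap.2 fun p hp ↦ by
      rw [Submodule.mem_comap, Submodule.mem_comap]
      by_cases hi : i ≤ k
      · rw [hJ k p hp.2 i hi]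
        exact N.smul_mem _ (Module.End.pow_apply_mem_of_forall_mem i heN p hp.1)
      · rw [pow_apply_primitive_of_lt hp.2 (not_le.1 hi), map_zero]
        exact N.zero_mem
  exact hle hx

end HasLefschetzProperty

/-- ★ **The twist multiplies the primitive forms by signs: `β_k(ψ(·, J·)) = (−1)ᵏ β_k(ψ)`** (`ψ(p, J eᵏq) = (−1)ᵏ ψ(p, eᵏq)`).
[cite: LooijengaLunts1997, §1 p0005 L21–L26 and (1.16) p0008 L77–L83] -/
theorem primitiveForms_compl₂_of_stringSign (hJ : ∀ k, ∀ p ∈ primitiveSpace h e k, ∀ i ≤ k, J ((e ^ i) p) = (-1 : K) ^ i • (e ^ i) p) (k : ℕ) :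
    primitiveForms h e (ψ.compl₂ J) k = ((-1 : K) ^ k) • primitiveForms h e ψ k := by
  refine LinearMap.ext fun p ↦ LinearMap.ext fun q ↦ ?_
  rw [primitiveForms_apply, LinearMap.compl₂_apply, hJ k q q.2 k le_rfl, map_smul, LinearMap.smul_apply, LinearMap.smul_apply, primitiveForms_apply]

/-! ### §3 Poincaré-type pairings: `h` skew, `e` self-adjoint -/

namespace HasLefschetzProperty

variable [CharZero K] [FiniteDimensional K M]

omit [FiniteDimensional K M] in
/-- ★ **THE PRIMARY DECOMPOSITION IS `ψ`-ORTHOGONAL FOR A POINCARÉ-TYPE PAIRING**: `⊕_{k∈T} M[k] ≤ (⊕_{k∈S} M[k])^{⊥ψ}` for disjoint `S, T` (g30-#3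
`apply_pow_primitive_pow_primitive_eq_zero`: `ψ(eⁱp, eⁱ′p′) = 0` unless the types agree). [cite: Andre1996Motifs, §1.1 (p0008 L11–L14)]
[cite: LooijengaLunts1997, §1 (1.6) proof p0006 L10–L14 ("This decomposition is `φ`-perpendicular")] -/
theorem biSup_le_orthogonal_of_disjoint_of_isSelfAdjoint (L : HasLefschetzProperty h e) (hψh : ψ.IsSkewAdjoint h) (hψe : ψ.IsSelfAdjoint e)
    {S T : Set ℕ} (hST : Disjoint S T) :
    ⨆ k ∈ T, ⨆ i : ℕ, (primitiveSpace h e k).map (e ^ i) ≤ ψ.orthogonal (⨆ k ∈ S, ⨆ i : ℕ, (primitiveSpace h e k).map (e ^ i)) := by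
  refine iSup₂_le fun k₂ hk₂ ↦ iSup_le fun b ↦ Submodule.map_le_iff_le_comap.2 fun q hq ↦ ?_
  rw [Submodule.mem_comap, LinearMap.BilinForm.mem_orthogonal_iff]
  suffices hle : ⨆ k ∈ S, ⨆ i : ℕ, (primitiveSpace h e k).map (e ^ i) ≤ LinearMap.ker (LinearMap.flip ψ ((e ^ b) q)) from
    fun n hn ↦ by
      have h1 := hle hn
      rwa [LinearMap.mem_ker, LinearMap.flip_apply] at h1
  refine iSup₂_le fun k₁ hk₁ ↦ iSup_le fun a ↦ Submodule.map_le_iff_le_comap.2 fun p hp ↦ ?_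
  rw [Submodule.mem_comap, LinearMap.mem_ker, LinearMap.flip_apply]
  exact apply_pow_primitive_pow_primitive_eq_zero L hψh hψe hp hq fun hc ↦ hST.ne_of_mem hk₁ hk₂ hc.1

/-- ★★★ **A POINCARÉ-TYPE PAIRING IS NON-DEGENERATE IFF EVERY `γ_k(p, q) = ψ(p, eᵏq)` IS NON-DEGENERATE ON `P_{−k}`** — via the twist: `ψ(·, J·)` is invariant,
non-degenerate iff `ψ` is (`J² = 1`), with primitive forms `(−1)ᵏγ_k`, and row g59-#8 applies ("If this form is nondegenerate … then the form `(a, b) ↦ ∫(ab)` is also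
nondegenerate"). [cite: LooijengaLunts1997, §1 p0005 L21–L30 and (1.16) p0008 L77–L83] [cite: Andre1996Motifs, §1.1 (p0008 L11–L14)] -/
theorem nondegenerate_iff_forall_primitiveForms_of_isSelfAdjoint (L : HasLefschetzProperty h e) (hgr : IsZGrading h) (hψh : ψ.IsSkewAdjoint h)
    (hψe : ψ.IsSelfAdjoint e) : ψ.Nondegenerate ↔ ∀ k, (primitiveForms h e ψ k).Nondegenerate := by
  obtain ⟨J, hJ⟩ := L.exists_stringSign hgr
  have hJJ := L.stringSign_mul_self hgr hJ
  have hli : LeftInverse J J := fun x ↦ by rw [← Module.End.mul_apply, hJJ, Module.End.one_apply]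
  have hφ : ψ.compl₂ J ∈ invariantForms h e :=
    compl₂_mem_invariantForms_of_isSelfAdjoint hψh hψe (L.stringSign_comm_h hgr hJ) (L.stringSign_anticomm_e hgr hJ)
  rw [← nondegenerate_compl₂_iff ⟨hli.injective, hli.surjective⟩, L.nondegenerate_iff_forall_primitiveForms hgr hφ.1 hφ.2]
  refine forall_congr' fun k ↦ ?_
  rw [primitiveForms_compl₂_of_stringSign hJ k, nondegenerate_smul_iff₇₃ (pow_ne_zero k (neg_ne_zero.2 one_ne_zero))]

/-- ★★ **`(⊕_{k∈S} M[k])^{⊥ψ} = ⊕_{k∉S} M[k]` FOR A NON-DEGENERATE POINCARÉ-TYPE PAIRING** (the complementary blocks lie in the orthogonal and have the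
complementary dimension). [cite: Andre1996Motifs, §1.1 (p0008 L11–L14)] [cite: LooijengaLunts1997, §1 (1.6) proof p0006 L10–L14] -/
theorem orthogonal_biSup_eq_of_isSelfAdjoint (L : HasLefschetzProperty h e) (hgr : IsZGrading h) (hψh : ψ.IsSkewAdjoint h) (hψe : ψ.IsSelfAdjoint e)
    (hψ : ψ.Nondegenerate) (S : Set ℕ) :
    ψ.orthogonal (⨆ k ∈ S, ⨆ i : ℕ, (primitiveSpace h e k).map (e ^ i)) = ⨆ k ∈ Sᶜ, ⨆ i : ℕ, (primitiveSpace h e k).map (e ^ i) := by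
  refine (Submodule.eq_of_le_of_finrank_eq (L.biSup_le_orthogonal_of_disjoint_of_isSelfAdjoint hψh hψe disjoint_compl_right) ?_).symm
  rw [LinearMap.BilinForm.finrank_orthogonal hψ]
  have h1 := L.finrank_biSup_add_finrank_biSup_compl hgr S
  omega

/-- **`M = (⊕_{k∈S} M[k]) ⊕ (⊕_{k∈S} M[k])^{⊥ψ}`** for a non-degenerate Poincaré-type pairing. [cite: Andre1996Motifs, §1.1 (p0008 L11–L14)]
[cite: LooijengaLunts1997, §1 (1.6) proof p0006 L9–L14] -/
theorem isCompl_biSup_orthogonal_of_isSelfAdjoint (L : HasLefschetzProperty h e) (hgr : IsZGrading h) (hψh : ψ.IsSkewAdjoint h)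
    (hψe : ψ.IsSelfAdjoint e) (hψ : ψ.Nondegenerate) (S : Set ℕ) :
    IsCompl (⨆ k ∈ S, ⨆ i : ℕ, (primitiveSpace h e k).map (e ^ i)) (ψ.orthogonal (⨆ k ∈ S, ⨆ i : ℕ, (primitiveSpace h e k).map (e ^ i))) := by
  rw [L.orthogonal_biSup_eq_of_isSelfAdjoint hgr hψh hψe hψ S]
  exact L.isCompl_biSup_biSup_compl hgr S

/-- ★★ **`ψ` RESTRICTED TO ANY SUM OF BLOCKS `⊕_{k∈S} M[k]` IS NON-DEGENERATE** for a non-degenerate Poincaré-type pairing (right: `M_S ∩ M_S^⊥ = 0`, row g59-#7's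
`inf_orthogonal_eq_bot_iff_separatingRight`; left: the same for `ψᵀ`, also of Poincaré type). [cite: Andre1996Motifs, §1.1 (p0008 L11–L14)]
[cite: LooijengaLunts1997, §1 (1.6) proof p0006 L10–L20 ("`φ` is nondegenerate on each summand `ℂ[e_k]P_{−k}`")] -/
theorem nondegenerate_restrict_biSup_of_isSelfAdjoint (L : HasLefschetzProperty h e) (hgr : IsZGrading h) (hψh : ψ.IsSkewAdjoint h)
    (hψe : ψ.IsSelfAdjoint e) (hψ : ψ.Nondegenerate) (S : Set ℕ) : (ψ.restrict (⨆ k ∈ S, ⨆ i : ℕ, (primitiveSpace h e k).map (e ^ i))).Nondegenerate := by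
  have hR : (ψ.restrict (⨆ k ∈ S, ⨆ i : ℕ, (primitiveSpace h e k).map (e ^ i))).SeparatingRight :=
    inf_orthogonal_eq_bot_iff_separatingRight.1 (L.isCompl_biSup_orthogonal_of_isSelfAdjoint hgr hψh hψe hψ S).inf_eq_bot
  have hR' : (LinearMap.BilinForm.restrict (LinearMap.flip ψ) (⨆ k ∈ S, ⨆ i : ℕ, (primitiveSpace h e k).map (e ^ i))).SeparatingRight :=
    inf_orthogonal_eq_bot_iff_separatingRight.1
      (L.isCompl_biSup_orthogonal_of_isSelfAdjoint hgr (isSkewAdjoint_flip₇₃ hψh) (isSelfAdjoint_flip₇₃ hψe) (LinearMap.flip_nondegenerate.2 hψ) S).inf_eq_bot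
  exact ⟨fun p hp ↦ hR' p fun q ↦ hp q, hR⟩

/-- **`ψ|_{M[k]}` is non-degenerate** for a non-degenerate Poincaré-type pairing and every block `M[k] = ⊕ᵢ eⁱP_{−k}`. [cite: Andre1996Motifs, §1.1 (p0008 L11–L14)]
[cite: LooijengaLunts1997, §1 (1.6) proof p0006 L10–L20] -/
theorem nondegenerate_restrict_iSup_map_pow_of_isSelfAdjoint (L : HasLefschetzProperty h e) (hgr : IsZGrading h) (hψh : ψ.IsSkewAdjoint h)
    (hψe : ψ.IsSelfAdjoint e) (hψ : ψ.Nondegenerate) (k : ℕ) : (ψ.restrict (⨆ i : ℕ, (primitiveSpace h e k).map (e ^ i))).Nondegenerate := by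
  rw [← biSup_singleton₇₃ (h := h) (e := e) k]
  exact L.nondegenerate_restrict_biSup_of_isSelfAdjoint hgr hψh hψe hψ {k}

end HasLefschetzProperty

/-- ★ **THE ADJOINT OF A MORPHISM OF LEFSCHETZ MODULES FOR POINCARÉ-TYPE PAIRINGS IS A MORPHISM OF LEFSCHETZ MODULES** (`h`, `h′` skew and `e`, `e′`
self-adjoint; row g59-#6 `semiconj_adjoint_of_isAdjointPair` with the adjoint pairs `(h, −h)` and `(e, e)`). [cite: Andre1996Motifs, §1.1 (p0008 L11–L14)]
[cite: GoodmanWallachGTM255, §3.2 Theorem 3.2.14 proof (p0253 L9–L12)] -/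
theorem semiconj_adjoint_of_isSelfAdjoint_of_isSkewAdjoint {M' : Type*} [AddCommGroup M'] [Module K M'] {ψ' : BilinForm K M'} {h' e' : Module.End K M'}
    {Φ : M →ₗ[K] M'} {Ψ : M' →ₗ[K] M} (hψ : ψ.SeparatingRight) (hψh : ψ.IsSkewAdjoint h) (hψe : ψ.IsSelfAdjoint e) (hψh' : ψ'.IsSkewAdjoint h')
    (hψe' : ψ'.IsSelfAdjoint e') (hadj : LinearMap.IsAdjointPair ψ ψ' Φ Ψ) (hh : ∀ x, Φ (h x) = h' (Φ x)) (he : ∀ x, Φ (e x) = e' (Φ x)) :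
    (∀ y, Ψ (h' y) = h (Ψ y)) ∧ ∀ y, Ψ (e' y) = e (Ψ y) :=
  ⟨semiconj_adjoint_of_isSkewAdjoint hψ hψh hψh' hadj hh, semiconj_adjoint_of_isAdjointPair hψ hψe hψe' hadj he⟩

end Literature.Algebra.Lie
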